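import Literature.AlgebraicGeometry.Frobenioids.PadicFrobenioidTwistUnique
import Literature.AlgebraicGeometry.Frobenioids.PadicFrobenioidTwistSplitting
import Literature.AlgebraicGeometry.Frobenioids.PadicFrobenioidMonoidData
import HarnessLib

/-!
# Frobenioids II, Remark 1.2.2, sentences 3–4: the constancy reading (R1) is NECESSARY — `u_D · τ` is a
# characteristic splitting, resp. the automorphism `U` exists (for a nowhere-torsion section `u_D`), iff
# every pull-back of `Φ` is bijective (proof-only)

Mochizuki, *The geometry of Frobenioids II: poly-Frobenioids*, Kyushu J. Math. **62** (2008) 401–460,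
§1, Remark 1.2.2, kurims p. 10 [cite: MochizukiFrdII2008, Rmk 1.2.2 p.10]: "Suppose that `Φ` is absolutely
primitive, and that `Λ = ℤ` … one obtains a unique automorphism `U` of the data `(Φ, B → Φ^gp)` which is
the identity on `O^×(−)` … and `Φ`, but which maps `τ` … to `u_D · τ`."

PROOF-ONLY companion of `PadicFrobenioidRmk122.lean` (abc-iut cell, seat abc-iut-f-046; FACT-LIST rows
F-1184 `MapsSplittingTo` / F-1185 `Rmk122UOfBijective`, [FrdII] Rmk 1.2.2 p. 10; cell FINDING T4g2-F1 of
abc-iut-L1-t4 gen 2, recorded in the module docstring of `PadicFrobenioidRmk122.lean`).  Seat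
abc-iut-L1-t4 typed sentence 4 under the explicit constancy reading (R1) "every pull-back map of `Φ` is
bijective" (`HasBijectivePullbacks`), and abc-iut-w5 PROVED it under (R1) (`rmk122UOfBijective_holds`,
`PadicFrobenioidTwistUnique.lean`); the finding says that WITHOUT (R1) the printed construction breaks
"as soon as the generator of `Φ(A_D) ≅ ℤ_{≥0}` changes degree along an arrow of `D`" (hand witness).
This file turns the hand argument into kernel theorems, for EVERY absolutely primitive datum:

* `pow_eq_self_of_fixesUnits_mapsSplittingTo` — if `U = (η, β)` is the identity on `O^×(−)` and maps `τ`
  to `u_D · τ`, then along every arrow `f : A → A'` of `D`, with `Φ(f)(g_{A'}) = g_A^k` (`g` the generators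
  of `Φ ≅ ℤ_{≥0}`), naturality of `β` forces `u_A^k = u_A`: indeed `B(f)(u_{η'}) = u_η^k · w`, `w ∈ O^×(A)`,
  so `β_A(B(f) u_{η'}) = B(f)(u_{η'}) · u_A^k` while `B(f)(β_{A'} u_{η'}) = B(f)(u_{η'}) · u_A`;
* `surjective_mapΦ_of_fixesUnits_mapsSplittingTo` — hence, if `u_A` is not torsion, `k = 1`: the
  pull-back `Φ(f)` is surjective, and (pull-backs of `Φ` being injective for every datum, abc-iut-L1-d10's
  `map_Φ_injective`) bijective: `hasBijectivePullbacks_of_exists_rmk122U`;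
* `exists_unitSection_forall_pow_ne_one` — every datum carries a NOWHERE-TORSION section of `O^×(−)`
  (the section over `1 + p`, abc-iut-L1's `exists_unitSection_onePlusP`; `(1 + p)^m ≠ 1` for `m ≥ 1`);
* `hasBijectivePullbacks_iff_rmk122U` — **(R1) ⟺ printed sentence 4**: for `Φ` absolutely primitive,
  every pull-back of `Φ` is bijective iff for every section `u_D` of `O^×(−)` and every characteristic
  splitting `τ` there is a unique automorphism `U` of the data, the identity on `Φ` and on `O^×(−)`, mapping
  `τ` to `u_D · τ` (⟸ is new; ⟹ is `rmk122UOfBijective_holds`); `not_rmk122U_of_not_surjective` — at any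
  arrow where `Φ(f)` is not surjective, print's `U` does not exist for the `(1 + p)`-section;
* `pow_eq_self_of_twist_characteristicSplitting`, `surjective_mapΦ_of_twist_characteristicSplitting`,
  `not_rmk122Twist_of_not_surjective`, `hasBijectivePullbacks_iff_rmk122Twist` — the same for **sentence 3**
  ("`u_D · τ` is a new characteristic splitting", abc-iut-w5's `rmk122TwistOfBijective_holds` under (R1)):
  both [FrdI] Def. 2.3 subfunctors `τ` and `u_D · τ = (η · w)^{ℤ_{≥0}}` transport the generators along a
  linear `(A, 0) → (A', 0)`, and comparing rational functions gives again `u_A^k = u_A`;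
* `rmk122_sentences_iff_hasBijectivePullbacks` — summary: (R1) ⟺ sentence 3 ⟺ sentence 4.

So reading (R1) is not a convenience of the typing but the exact domain of validity of Remark 1.2.2,
sentence 4 (it holds e.g. for the "constant" monoids `Φ_{C_v}`, `Φ_{C_v^⊢}` of [IUTchI] Ex. 3.2–3.3 and over
one-object bases — `existsUnique_rmk122U_primQp`, `PadicFrobenioidRmk122Closures.lean`).  Refereed
preparatory material; a Remark, not used in the [IUTchIII] Cor. 3.12 cone; no side taken; typed ≠ proved
elsewhere.  No definition, no new statement of print.
-/

namespace Literature.AlgebraicGeometry.Frobenioids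

namespace PadicFrd

open CategoryTheory Opposite Function

universe v u

namespace Datum

variable {D : Type u} [Category.{v} D] {p : ℕ} [Fact p.Prime] (d : Datum D p)

/-- `End.asHom` turns products into composites. [folklore] -/
private theorem asHom_mul {X : d.frobenioid} (a b : End X) : End.asHom (a * b) = End.asHom b ≫ End.asHom a :=
  rfl

/-- A non-torsion unit `x` with `x^k = x` has `k = 1`. [folklore] -/
private theorem eq_one_of_pow_eq_self {M : Type*} [CommMonoid M] {x : M} (hx : IsUnit x)
    (hs : ∀ m : ℕ, 0 < m → x ^ m ≠ 1) {k : ℕ} (hk : x ^ k = x) : k = 1 := by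
  by_contra hne
  rcases Nat.lt_or_gt_of_ne hne with hlt | hgt
  · have hk0 : k = 0 := by omega
    rw [hk0, pow_zero] at hk
    exact hs 1 one_pos (by rw [pow_one]; exact hk.symm)
  · obtain ⟨j, rfl⟩ : ∃ j, k = j + 1 + 1 := ⟨k - 2, by omega⟩
    apply hs (j + 1) (Nat.succ_pos j)
    apply hx.mul_left_cancel
    rw [← pow_succ', hk, mul_one]

/-! ### A nowhere-torsion section of `O^×(−)` -/

/-- **Every datum carries a NOWHERE-TORSION section `u_D` of `O^×(−)`**: the section over `1 + p ∈ O_{K_A}^×`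
(abc-iut-L1's `exists_unitSection_onePlusP`) has `u_A^m ≠ 1` for all `A` and all `m ≥ 1`, since
`(1 + p)^m = 1` in the `ℚ_p`-algebra `K_A` would give `(1 + p)^m = 1` in `ℕ`.
[cite: MochizukiFrdII2008, Rmk 1.2.2 p.10] -/
theorem exists_unitSection_forall_pow_ne_one :
    ∃ s : d.UnitSection, ∀ (A : D) (m : ℕ), 0 < m → s.u A ^ m ≠ 1 := by
  obtain ⟨u, hu_div, -, hu_val, hu_nat⟩ := d.exists_unitSection_onePlusP
  refine ⟨⟨fun A => (u A : d.B.obj (op A)), hu_div, fun f => hu_nat f⟩, fun A m hm h => ?_⟩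
  change (u A : d.B.obj (op A)) ^ m = 1 at h
  obtain ⟨⟨inst, hfin, hc⟩⟩ := d.isPadicLocal A
  letI := inst
  have hK : ((d.resK A (u A : d.B.obj (op A)) : (d.fld A)ˣ) : d.fld A) ^ m = 1 := by
    rw [← Units.val_pow_eq_pow_val, ← map_pow, h, map_one, Units.val_one]
  rw [hu_val A] at hK
  have hQ : ((1 + (p : ℕ) : ℚ_[p])) ^ m = 1 := (algebraMap ℚ_[p] (d.fld A)).injective (by
    simp only [map_pow, map_add, map_one, map_natCast]
    exact hK)
  have hnat : ((1 + p) ^ m : ℕ) = 1 := by exact_mod_cast hQ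
  have hp1 : 1 < 1 + p := by
    have := (Fact.out : p.Prime).one_lt
    omega
  exact absurd hnat (Nat.one_lt_pow hm.ne' hp1).ne'

/-! ### Naturality of `β` along an arrow of `D` pins the degree change of the generators -/

/-- **The key computation.**  Let `Φ` be absolutely primitive, `τ` a characteristic splitting, `u_D` a section
of `O^×(−)`, and `U = (η, β)` a morphism of the data which is the identity on `O^×(−)` and maps `τ` to
`u_D · τ`.  Let `X`, `X'` be objects over `A`, `A'`, `f : A → A'` an arrow of `D`, `η`, `η'` the generators of
`τ(X)`, `τ(X')`, and `Φ(f)(Div η') = (Div η)^k`.  Then `u_A^k = u_A`.  (Naturality of `β` at `f`, evaluated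
on the rational function `u_{η'}`: `B(f)(u_{η'}) = u_η^k · w` with `w ∈ O^×(A)`, so the two sides are
`B(f)(u_{η'}) · u_A` and `B(f)(u_{η'}) · u_A^k`.) [cite: MochizukiFrdII2008, Rmk 1.2.2 p.10] -/
theorem pow_eq_self_of_fixesUnits_mapsSplittingTo
    (T : PreFrobenioid.CharacteristicSplitting d.structureFunctor) (s : d.UnitSection)
    {U : ModelFrobenioid.DataHom d.divB d.divB} (hfix : d.FixesUnits U) (hmaps : d.MapsSplittingTo U s T.τ)
    {X X' : d.frobenioid} (f : X.base ⟶ X'.base)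
    {η : End X} (hη : IsGeneratorOf η (T.τ X)) {η' : End X'} (hη' : IsGeneratorOf η' (T.τ X'))
    {k : ℕ} (hk : (d.Φ.map f.op).hom (ModelFrobenioid.div (End.asHom η')) = ModelFrobenioid.div (End.asHom η) ^ k) :
    s.u X.base ^ k = s.u X.base := by
  -- divisors: `Div_B(u_η) = [Div η]`, `Div_B(B(f) u_{η'}) = Φ(f)[Div η'] = [Div η]^k = Div_B(u_η^k)`
  have hdivη : Frobenioids.divB d.Φ d.B d.divB (op X.base) (ModelFrobenioid.unit (End.asHom η)) =
      Algebra.GrothendieckGroup.of (ModelFrobenioid.div (End.asHom η)) :=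
    (d.of_div_eq_divB_unit (d.τ_le' T X hη.1)).symm
  have hdivη' : Frobenioids.divB d.Φ d.B d.divB (op X'.base) (ModelFrobenioid.unit (End.asHom η')) =
      Algebra.GrothendieckGroup.of (ModelFrobenioid.div (End.asHom η')) :=
    (d.of_div_eq_divB_unit (d.τ_le' T X' hη'.1)).symm
  have hdivb : Frobenioids.divB d.Φ d.B d.divB (op X.base) ((d.B.map f.op).hom (ModelFrobenioid.unit (End.asHom η'))) =
      Frobenioids.divB d.Φ d.B d.divB (op X.base) (ModelFrobenioid.unit (End.asHom η) ^ k) := by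
    rw [← pullGp_divB, hdivη', pullGp_of, hk, map_pow, map_pow, hdivη]
  -- `w := B(f)(u_{η'}) · u_η^{-k} ∈ O^×(A)` is fixed by `β`
  obtain ⟨cη, hcη⟩ := d.isUnit_B (op X.base) (ModelFrobenioid.unit (End.asHom η))
  have hck : ((cη ^ k : (d.B.obj (op X.base))ˣ) : d.B.obj (op X.base)) = ModelFrobenioid.unit (End.asHom η) ^ k := by
    rw [Units.val_pow_eq_pow_val, hcη]
  have hw : Frobenioids.divB d.Φ d.B d.divB (op X.base)
      ((d.B.map f.op).hom (ModelFrobenioid.unit (End.asHom η')) *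
        ((cη ^ k)⁻¹ : (d.B.obj (op X.base))ˣ)) = 1 := by
    rw [map_mul, ← Units.coe_map_inv, Units.mul_inv_eq_one, Units.coe_map, hck, hdivb]
  have hbw : (d.B.map f.op).hom (ModelFrobenioid.unit (End.asHom η')) =
      (d.B.map f.op).hom (ModelFrobenioid.unit (End.asHom η')) * ((cη ^ k)⁻¹ : (d.B.obj (op X.base))ˣ) *
        ModelFrobenioid.unit (End.asHom η) ^ k := by
    rw [mul_assoc, ← hck, Units.inv_mul, mul_one]
  -- `β_A(B(f) u_{η'}) = B(f)(u_{η'}) · u_A^k`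
  have hβu : (U.β.app (op X.base)).hom (ModelFrobenioid.unit (End.asHom η)) =
      ModelFrobenioid.unit (End.asHom η) * s.u X.base := hmaps X η hη
  have hβb : (U.β.app (op X.base)).hom ((d.B.map f.op).hom (ModelFrobenioid.unit (End.asHom η'))) =
      (d.B.map f.op).hom (ModelFrobenioid.unit (End.asHom η')) * s.u X.base ^ k := by
    conv_lhs => rw [hbw]
    rw [map_mul, hfix (op X.base) _ hw, map_pow, hβu, mul_pow, ← mul_assoc, ← hbw]
  -- naturality of `β` at `f`, evaluated at `u_{η'}`: `β_A(B(f) u_{η'}) = B(f)(β_{A'} u_{η'}) = B(f)(u_{η'}) · u_A`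
  have hnat : (U.β.app (op X.base)).hom ((d.B.map f.op).hom (ModelFrobenioid.unit (End.asHom η'))) =
      (d.B.map f.op).hom (ModelFrobenioid.unit (End.asHom η')) * s.u X.base := by
    have h := congrArg (fun φ => φ.hom (ModelFrobenioid.unit (End.asHom η'))) (U.β.naturality f.op)
    simp only [CommMonCat.hom_comp, MonoidHom.comp_apply] at h
    rw [h, hmaps X' η' hη', map_mul, s.map_u f]
  -- compare
  rw [hβb] at hnat
  exact (d.isUnit_B (op X.base) _).mul_left_cancel hnat

/-- **Necessity of (R1), pointwise**: with `U`, `u_D`, `τ` as above, if `u_A` is not torsion then the pull-back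
`Φ(f) : Φ(A') → Φ(A)` along every arrow `f : A → A'` is SURJECTIVE (the generator `g_{A'}` maps to the
generator `g_A`, not to a proper power). [cite: MochizukiFrdII2008, Rmk 1.2.2 p.10] -/
theorem surjective_mapΦ_of_fixesUnits_mapsSplittingTo (hap : d.IsAbsolutelyPrimitive)
    (T : PreFrobenioid.CharacteristicSplitting d.structureFunctor) (s : d.UnitSection)
    {U : ModelFrobenioid.DataHom d.divB d.divB} (hfix : d.FixesUnits U) (hmaps : d.MapsSplittingTo U s T.τ)
    {A A' : D} (f : A ⟶ A') (hs : ∀ m : ℕ, 0 < m → s.u A ^ m ≠ 1) :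
    Surjective (d.Φ.map f.op).hom := by
  obtain ⟨η, hη⟩ := d.exists_isGeneratorOf_τ T hap (ModelFrobenioid.zeroObj d.Φ d.B d.divB A)
  obtain ⟨η', hη'⟩ := d.exists_isGeneratorOf_τ T hap (ModelFrobenioid.zeroObj d.Φ d.B d.divB A')
  obtain ⟨hgen, -⟩ := d.div_isGenerator_of_isGeneratorOf T hap hη
  obtain ⟨hgen', -⟩ := d.div_isGenerator_of_isGeneratorOf T hap hη'
  obtain ⟨k, hk⟩ := hgen ((d.Φ.map f.op).hom (ModelFrobenioid.div (End.asHom η')))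
  have hsk : s.u A ^ k = s.u A := d.pow_eq_self_of_fixesUnits_mapsSplittingTo T s hfix hmaps f hη hη' hk
  -- `u_A` not torsion forces `k = 1`
  have hk1 : k = 1 := eq_one_of_pow_eq_self (d.isUnit_B (op A) (s.u A)) hs hsk
  subst hk1
  rw [pow_one] at hk
  intro x
  obtain ⟨j, rfl⟩ := hgen x
  exact ⟨ModelFrobenioid.div (End.asHom η') ^ j, by rw [map_pow, hk]⟩

/-- **Necessity of (R1)**: if for a NOWHERE-TORSION section `u_D` (e.g. the `(1 + p)`-section) and some
characteristic splitting `τ` an automorphism `U` of the data which is the identity on `O^×(−)` and maps `τ` to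
`u_D · τ` EXISTS, then every pull-back map of `Φ` is bijective (surjective by the above, injective for every
datum — abc-iut-L1-d10's `map_Φ_injective`). [cite: MochizukiFrdII2008, Rmk 1.2.2 p.10] -/
theorem hasBijectivePullbacks_of_exists_rmk122U (hap : d.IsAbsolutelyPrimitive)
    (T : PreFrobenioid.CharacteristicSplitting d.structureFunctor) (s : d.UnitSection)
    (hs : ∀ (A : D) (m : ℕ), 0 < m → s.u A ^ m ≠ 1)
    (hU : ∃ U : ModelFrobenioid.DataHom d.divB d.divB, d.FixesUnits U ∧ d.MapsSplittingTo U s T.τ) :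
    d.HasBijectivePullbacks := by
  obtain ⟨U, hfix, hmaps⟩ := hU
  intro A A' f
  exact ⟨d.map_Φ_injective f, d.surjective_mapΦ_of_fixesUnits_mapsSplittingTo hap T s hfix hmaps f (hs A)⟩

/-- **Remark 1.2.2, sentence 4 WITHOUT (R1) fails wherever a pull-back of `Φ` is not surjective**: for the
nowhere-torsion sections `u_D` of `exists_unitSection_forall_pow_ne_one` and ANY characteristic splitting
`τ`, no morphism of the data is the identity on `O^×(−)` and maps `τ` to `u_D · τ` (kernel form of cell
FINDING T4g2-F1 for sentence 4: the printed, hypothesis-free sentence is valid exactly in the constant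
regime). [cite: MochizukiFrdII2008, Rmk 1.2.2 p.10] -/
theorem not_rmk122U_of_not_surjective (hap : d.IsAbsolutelyPrimitive)
    (T : PreFrobenioid.CharacteristicSplitting d.structureFunctor) {A A' : D} (f : A ⟶ A')
    (hf : ¬ Surjective (d.Φ.map f.op).hom) :
    ∃ s : d.UnitSection, ¬ ∃ U : ModelFrobenioid.DataHom d.divB d.divB,
      d.FixesUnits U ∧ d.MapsSplittingTo U s T.τ := by
  obtain ⟨s, hs⟩ := d.exists_unitSection_forall_pow_ne_one
  exact ⟨s, fun ⟨U, hfix, hmaps⟩ =>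
    hf (d.surjective_mapΦ_of_fixesUnits_mapsSplittingTo hap T s hfix hmaps f (hs A))⟩

/-- **(R1) ⟺ Remark 1.2.2, sentence 4** (for `Φ` absolutely primitive): every pull-back map of `Φ` is
bijective IFF for every section `u_D` of `O^×(−)` and every characteristic splitting `τ` on `C` there is a
UNIQUE automorphism `U` of the data `(Φ, B → Φ^gp)` which is the identity on `Φ` and on `O^×(−)` and maps `τ`
to `u_D · τ`.  (⟹: abc-iut-w5's `rmk122UOfBijective_holds`; ⟸: the `(1 + p)`-section and the splitting
`τ_p` of Thm. 1.2 (v), `pSplitting`.)  The constancy reading (R1) of seat abc-iut-L1-t4 is thus the EXACT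
domain of validity of the printed sentence. [cite: MochizukiFrdII2008, Rmk 1.2.2 p.10] -/
theorem hasBijectivePullbacks_iff_rmk122U (hap : d.IsAbsolutelyPrimitive) :
    d.HasBijectivePullbacks ↔
      ∀ (s : d.UnitSection) (T : PreFrobenioid.CharacteristicSplitting d.structureFunctor),
        ∃! U : ModelFrobenioid.DataHom d.divB d.divB,
          d.IsDataAutomorphism U ∧ d.FixesUnits U ∧ d.MapsSplittingTo U s T.τ := by
  refine ⟨fun hbij s T => d.rmk122UOfBijective_holds hbij hap s T, fun h => ?_⟩
  obtain ⟨s, hs⟩ := d.exists_unitSection_forall_pow_ne_one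
  obtain ⟨U, ⟨-, hfix, hmaps⟩, -⟩ := h s (d.pSplitting hap)
  exact d.hasBijectivePullbacks_of_exists_rmk122U hap (d.pSplitting hap) s hs ⟨U, hfix, hmaps⟩

/-- The same with the typed statement: under absolute primitivity, **`Rmk122UOfBijective`'s hypothesis
`HasBijectivePullbacks` is equivalent to its conclusion**. [cite: MochizukiFrdII2008, Rmk 1.2.2 p.10] -/
theorem hasBijectivePullbacks_iff_rmk122U_conclusion (hap : d.IsAbsolutelyPrimitive) :
    d.HasBijectivePullbacks ↔
      ∀ (s : d.UnitSection) (T : PreFrobenioid.CharacteristicSplitting d.structureFunctor),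
        ∃ U : ModelFrobenioid.DataHom d.divB d.divB, d.FixesUnits U ∧ d.MapsSplittingTo U s T.τ := by
  refine ⟨fun hbij s T => ?_, fun h => ?_⟩
  · obtain ⟨U, ⟨-, hfix, hmaps⟩, -⟩ := d.rmk122UOfBijective_holds hbij hap s T
    exact ⟨U, hfix, hmaps⟩
  · obtain ⟨s, hs⟩ := d.exists_unitSection_forall_pow_ne_one
    exact d.hasBijectivePullbacks_of_exists_rmk122U hap (d.pSplitting hap) s hs (h s (d.pSplitting hap))

/-! ### Sentence 3: "`u_D · τ` is a characteristic splitting" also forces bijective pull-backs -/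

/-- **The key computation for sentence 3.**  Let `Φ` be absolutely primitive, `τ` a characteristic splitting,
`u_D` a section of `O^×(−)`, and suppose `u_D · τ` IS (the family of) a characteristic splitting `τ'` ([FrdI]
Def. 2.3 as typed by abc-iut-L1-t2: in particular a subfunctor of `O^▷(−)` along linear morphisms).  Let
`φ : X → X'` be linear, `η`, `η'` the generators of `τ(X)`, `τ(X')` and `Φ(Base φ)(Div η') = (Div η)^k`.  Then
`u_A^k = u_A`: the subfunctor `τ` carries `η'` to `η^k` (so `B(Base φ)(u_{η'}) = u_η^k`), the subfunctor
`τ' = u_D · τ = (η · w)^{ℤ_{≥0}}` carries `η' · w_{X'}` to `(η · w_X)^k` (divisors), whose rational function is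
`u_η^k · u_A^k`, while transport gives `B(Base φ)(u_{η'} · u_{A'}) = u_η^k · u_A`.
[cite: MochizukiFrdII2008, Rmk 1.2.2 p.10] -/
theorem pow_eq_self_of_twist_characteristicSplitting (hap : d.IsAbsolutelyPrimitive)
    (T : PreFrobenioid.CharacteristicSplitting d.structureFunctor) (s : d.UnitSection)
    (T' : PreFrobenioid.CharacteristicSplitting d.structureFunctor) (hT' : T'.τ = s.twist T.τ)
    {X X' : d.frobenioid} (φ : X ⟶ X') (hφ : PreFrobenioid.IsLinear d.structureFunctor φ)
    {η : End X} (hη : IsGeneratorOf η (T.τ X)) {η' : End X'} (hη' : IsGeneratorOf η' (T.τ X'))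
    {k : ℕ} (hk : (d.Φ.map (ModelFrobenioid.baseMap φ).op).hom (ModelFrobenioid.div (End.asHom η')) =
      ModelFrobenioid.div (End.asHom η) ^ k) :
    s.u X.base ^ k = s.u X.base := by
  have hiX := d.thm12_isIsotropic X
  have hiX' := d.thm12_isIsotropic X'
  have hηO := d.τ_le' T X hη.1
  have hη'O := d.τ_le' T X' hη'.1
  obtain ⟨-, hinj⟩ := d.div_isGenerator_of_isGeneratorOf T hap hη
  -- Step A: `τ` transports `η'` to `η^k`, hence `B(Base φ)(u_{η'}) = u_η^k`
  obtain ⟨α₀, hα₀O, hα₀c, hα₀u, hα₀d⟩ := d.exists_endo_comp_eq φ hφ hη'O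
  have hα₀τ : α₀ ∈ T.τ X := T.res_mem hiX hiX' φ hφ η' hη'.1 α₀ hα₀O hα₀c
  have hα₀ : α₀ = η ^ k :=
    d.eq_of_mem_τ_of_div_eq T hα₀τ (Submonoid.pow_mem _ hη.1 k) (by rw [hα₀d, hk, d.div_pow_of_mem hηO])
  have huf : (d.B.map (ModelFrobenioid.baseMap φ).op).hom (ModelFrobenioid.unit (End.asHom η')) =
      ModelFrobenioid.unit (End.asHom η) ^ k := by
    rw [← hα₀u, hα₀, d.unit_pow_of_mem hηO]
  -- Step B: `τ' = u_D · τ` transports `η' · w_{X'}` into `(η · w_X)^{ℤ_{≥0}}`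
  have hβ'τ : η' * End.of (s.unitEnd X') ∈ T'.τ X' := by
    rw [hT']
    exact s.mul_unitEnd_mem_twist T.τ hη'
  have hβ'O : η' * End.of (s.unitEnd X') ∈ PreFrobenioid.endSubmonoid d.structureFunctor X' :=
    Submonoid.mul_mem _ hη'O (d.of_unitEnd_mem s X')
  obtain ⟨α, hαO, hαc, hαu, hαd⟩ := d.exists_endo_comp_eq φ hφ hβ'O
  have hατ' : α ∈ T'.τ X := T'.res_mem hiX hiX' φ hφ _ hβ'τ α hαO hαc
  rw [hT'] at hατ'
  obtain ⟨j, hj⟩ := (d.mem_twist_iff s T hap hη α).mp hατ'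
  -- divisors: `j = k`
  have hdivβ' : ModelFrobenioid.div (End.asHom (η' * End.of (s.unitEnd X'))) = ModelFrobenioid.div (End.asHom η') := by
    have h := d.div_twistGen_pow s hη'O 1
    rwa [pow_one, pow_one] at h
  have hjk : j = k := by
    apply hinj
    rw [← d.div_twistGen_pow s hηO j, ← hj, hαd, hdivβ', hk]
  subst hjk
  -- rational functions: `u_α = (u_η · u_A)^j` and `u_α = B(Base φ)(u_{η'} · u_{A'}) = u_η^j · u_A`
  have huηw : ModelFrobenioid.unit (End.asHom (η * End.of (s.unitEnd X))) =
      ModelFrobenioid.unit (End.asHom η) * s.u X.base := by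
    rw [asHom_mul, d.unit_comp_of_mem hηO (d.of_unitEnd_mem s X)]
    rfl
  have huη'w : ModelFrobenioid.unit (End.asHom (η' * End.of (s.unitEnd X'))) =
      ModelFrobenioid.unit (End.asHom η') * s.u X'.base := by
    rw [asHom_mul, d.unit_comp_of_mem hη'O (d.of_unitEnd_mem s X')]
    rfl
  have hu1 : ModelFrobenioid.unit (End.asHom α) = (ModelFrobenioid.unit (End.asHom η) * s.u X.base) ^ j := by
    rw [hj, d.unit_pow_of_mem (Submonoid.mul_mem _ hηO (d.of_unitEnd_mem s X)), huηw]
  have hu2 : ModelFrobenioid.unit (End.asHom α) = ModelFrobenioid.unit (End.asHom η) ^ j * s.u X.base := by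
    rw [hαu, huη'w, map_mul, huf, s.map_u]
  rw [hu1, mul_pow] at hu2
  exact ((d.isUnit_B (op X.base) (ModelFrobenioid.unit (End.asHom η))).pow j).mul_left_cancel hu2

/-- **Necessity of (R1) for sentence 3, pointwise**: if `u_D · τ` is a characteristic splitting and `u_A` is
not torsion, then the pull-back `Φ(f)` along every arrow `f : A → A'` of `D` is surjective (apply the key
computation to the linear morphism `(1, f, 0, 1) : (A, 0) → (A', 0)`). [cite: MochizukiFrdII2008, Rmk 1.2.2 p.10] -/
theorem surjective_mapΦ_of_twist_characteristicSplitting (hap : d.IsAbsolutelyPrimitive)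
    (T : PreFrobenioid.CharacteristicSplitting d.structureFunctor) (s : d.UnitSection)
    (T' : PreFrobenioid.CharacteristicSplitting d.structureFunctor) (hT' : T'.τ = s.twist T.τ)
    {A A' : D} (f : A ⟶ A') (hs : ∀ m : ℕ, 0 < m → s.u A ^ m ≠ 1) :
    Surjective (d.Φ.map f.op).hom := by
  obtain ⟨η, hη⟩ := d.exists_isGeneratorOf_τ T hap (ModelFrobenioid.zeroObj d.Φ d.B d.divB A)
  obtain ⟨η', hη'⟩ := d.exists_isGeneratorOf_τ T hap (ModelFrobenioid.zeroObj d.Φ d.B d.divB A')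
  obtain ⟨hgen, -⟩ := d.div_isGenerator_of_isGeneratorOf T hap hη
  obtain ⟨hgen', -⟩ := d.div_isGenerator_of_isGeneratorOf T hap hη'
  obtain ⟨k, hk⟩ := hgen ((d.Φ.map f.op).hom (ModelFrobenioid.div (End.asHom η')))
  have hφ : PreFrobenioid.IsLinear d.structureFunctor
      (ModelFrobenioid.zeroHom (Φ := d.Φ) (B := d.B) (DivB := d.divB) 1 f) :=
    ModelFrobenioid.degFr_zeroHom (Φ := d.Φ) (B := d.B) (DivB := d.divB) 1 f
  have hsk : s.u A ^ k = s.u A :=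
    d.pow_eq_self_of_twist_characteristicSplitting hap T s T' hT' (ModelFrobenioid.zeroHom 1 f) hφ hη hη' hk
  have hk1 : k = 1 := eq_one_of_pow_eq_self (d.isUnit_B (op A) (s.u A)) hs hsk
  subst hk1
  rw [pow_one] at hk
  intro x
  obtain ⟨j, rfl⟩ := hgen x
  exact ⟨ModelFrobenioid.div (End.asHom η') ^ j, by rw [map_pow, hk]⟩

/-- **Remark 1.2.2, sentence 3 WITHOUT (R1) fails wherever a pull-back of `Φ` is not surjective**: for the
nowhere-torsion section `u_D` over `1 + p` and ANY characteristic splitting `τ`, the family `u_D · τ` is NOT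
(the family of) a characteristic splitting — kernel form of cell FINDING T4g2-F1 (abc-iut-L1-t4 gen 2), for
every absolutely primitive datum. [cite: MochizukiFrdII2008, Rmk 1.2.2 p.10] -/
theorem not_rmk122Twist_of_not_surjective (hap : d.IsAbsolutelyPrimitive)
    (T : PreFrobenioid.CharacteristicSplitting d.structureFunctor) {A A' : D} (f : A ⟶ A')
    (hf : ¬ Surjective (d.Φ.map f.op).hom) :
    ∃ s : d.UnitSection, ¬ ∃ T' : PreFrobenioid.CharacteristicSplitting d.structureFunctor, T'.τ = s.twist T.τ := by
  obtain ⟨s, hs⟩ := d.exists_unitSection_forall_pow_ne_one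
  exact ⟨s, fun ⟨T', hT'⟩ => hf (d.surjective_mapΦ_of_twist_characteristicSplitting hap T s T' hT' f (hs A))⟩

/-- **(R1) ⟺ Remark 1.2.2, sentence 3** (for `Φ` absolutely primitive): every pull-back map of `Φ` is bijective
IFF for every section `u_D` of `O^×(−)` and every characteristic splitting `τ` on `C`, `u_D · τ` is again a
characteristic splitting (⟹: abc-iut-w5's `rmk122TwistOfBijective_holds`; ⟸: the `(1 + p)`-section and
`τ_p`).  So the typed `Rmk122TwistOfBijective` carries EXACTLY the right hypothesis.
[cite: MochizukiFrdII2008, Rmk 1.2.2 p.10] -/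
theorem hasBijectivePullbacks_iff_rmk122Twist (hap : d.IsAbsolutelyPrimitive) :
    d.HasBijectivePullbacks ↔
      ∀ (s : d.UnitSection) (T : PreFrobenioid.CharacteristicSplitting d.structureFunctor),
        ∃ T' : PreFrobenioid.CharacteristicSplitting d.structureFunctor, T'.τ = s.twist T.τ := by
  refine ⟨fun hbij s T => d.rmk122TwistOfBijective_holds hbij hap s T, fun h => ?_⟩
  obtain ⟨s, hs⟩ := d.exists_unitSection_forall_pow_ne_one
  obtain ⟨T', hT'⟩ := h s (d.pSplitting hap)
  intro A A' f
  exact ⟨d.map_Φ_injective f,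
    d.surjective_mapΦ_of_twist_characteristicSplitting hap (d.pSplitting hap) s T' hT' f (hs A)⟩

/-- **Summary — the three are equivalent** for an absolutely primitive datum: (R1) bijective pull-backs of
`Φ`; sentence 3 of Remark 1.2.2 for all `(u_D, τ)`; sentence 4 of Remark 1.2.2 for all `(u_D, τ)`.
[cite: MochizukiFrdII2008, Rmk 1.2.2 p.10] -/
theorem rmk122_sentences_iff_hasBijectivePullbacks (hap : d.IsAbsolutelyPrimitive) :
    ((∀ (s : d.UnitSection) (T : PreFrobenioid.CharacteristicSplitting d.structureFunctor),
        ∃ T' : PreFrobenioid.CharacteristicSplitting d.structureFunctor, T'.τ = s.twist T.τ) ↔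
      d.HasBijectivePullbacks) ∧
    ((∀ (s : d.UnitSection) (T : PreFrobenioid.CharacteristicSplitting d.structureFunctor),
        ∃! U : ModelFrobenioid.DataHom d.divB d.divB,
          d.IsDataAutomorphism U ∧ d.FixesUnits U ∧ d.MapsSplittingTo U s T.τ) ↔
      d.HasBijectivePullbacks) :=
  ⟨(d.hasBijectivePullbacks_iff_rmk122Twist hap).symm, (d.hasBijectivePullbacks_iff_rmk122U hap).symm⟩

end Datum

end PadicFrd

end Literature.AlgebraicGeometry.Frobenioids
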